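import Literature.MathematicalPhysics.QuantumFieldTheory.BalabanImbrieJaffe1984to88.BIJ88Sect5StatementsPart2
import Literature.MathematicalPhysics.QuantumFieldTheory.BalabanImbrieJaffe1984to88.BIJ88Sect4Statements

/-!
# `BalabanImbrieJaffe1984to88.BIJ88W3Chain298` — T. Bałaban, J. Imbrie, A. Jaffe, *Effective action and cluster properties of the
abelian Higgs model*, Commun. Math. Phys. **114** (1988) 257–315 [BalabanImbrieJaffe1988]: p. 298 [PDF 42] (Sect. 5.10), the SECOND
inequality of the chain *"|W₃^{(k)}(□)| ≤ [e^β(L^kε/ε₀)^{1/4−α}]^{n̄+1} ≤ e^{n̄β}(L^kε/ε₀)^κ, with κ > d as large as desired if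
n̄ > n̄(κ)"*, PROVED, and knitted with the first inequality (r16's leaf `BIJ88Sect5StatementsPart2.IneqW3`) into the shape of
(3.34) p. 270 (`BIJ88Sect3Statements.Ineq334`) at level k.

statement-level skeleton of published theorems with citation tags; proofs where landed; nothing here is a claim about the Yang–Mills mass gap

READING of «e^β» (recorded, not adjudicated here).  The print glosses β as an EXPONENT OF THE CHARGE e: p. 270, after (3.34)
*"|W₃^{(0)}(□)| ≦ e^{n̄β}(ε/ε₀)^κ"*: *"Here β > 0 is a fixed small power, κ > d is a fixed large power"*; p. 273: *"ε₀ =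
min{1, (8λ/e²)^{1/2}}e^β, with β > 0 small and e ≪ 1"* (typed with the charge in `BIJ88Sect4Statements.eps0`); p. 270 and p. 298
remove the diagrams *"whose combined order in λ^{1/2} and e is greater than n̄"*, so that each of the ≥ n̄ + 1 vertices of a W₃-term
carries a coupling constant, and *"each vertex results in at least a factor e^β(L^kε/ε₀)^{1/4−α}"*.  In this reading 0 < e^β ≤ 1 and
the second inequality of p. 298 holds for EVERY 0 < L^kε/ε₀ ≤ 1 as soon as κ ≤ (n̄+1)(1/4 − α) (`chain298`), exactly as printed
(*"κ … as large as desired if n̄ > n̄(κ)"*).  Two typed declarations read Euler's e instead — `BIJ88Sect3Statements.Ineq334`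
(`Real.exp (n̄β)`) and `BIJ88Sect5StatementsPart2.vertexFactor` (`Real.exp β · s^{1/4−α}`): the former is WEAKER than the print in
the charge reading and is derived below (`ineq334_of_chain`); with the latter the printed chain fails at L^kε/ε₀ = 1 for every β > 0
(`vertexFactor_chain_fails_at_one`), i.e. it would need extra smallness of L^kε/ε₀ not asked for in print.

Contents (theorems only; no definitions, no `Prop` facts):
* `rpow_pow_charge_le` — (e^β)^{n̄+1} ≤ e^{n̄β} for 0 < e ≤ 1, β ≥ 0;
* `rpow_pow_ratio_le` — (s^{1/4−α})^{n̄+1} ≤ s^κ for 0 < s ≤ 1, κ ≤ (n̄+1)(1/4−α);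
* `chain298` — the printed second inequality [e^β s^{1/4−α}]^{n̄+1} ≤ e^{n̄β} s^κ;
* `ineqW3_chain` — `IneqW3` with θ = e^β s^{1/4−α} ⟹ ∀ □, |W₃(□)| ≤ e^{n̄β} s^κ;
* `ineq334_of_chain` — ⟹ the typed (3.34)-shape `Ineq334 n̄ β (L^kε) ε₀ κ W₃` at level k (s = L^kε/ε₀);
* v1.1 (append-only): `ineq334c_of_chain_ratio` / `ineq334c_of_chain` — ⟹ r18's charge-reading statement `Ineq334c n̄ β e (L^kε) ε₀ κ W₃`
  (v1.3 of `BIJ88Sect3Statements`), with 0 < L^kε/ε₀ ≤ 1 resp. under the stopping rule; `ineq334_of_chain'` — consistency with `Ineq334c.toIneq334_of_lt`;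
* `ratio_le_one_of_continues` — the stopping rule `Continues L ε ε₀ k` (p. 273) gives s = L^kε/ε₀ ≤ 1;
* `vertexFactor_chain_fails_at_one` — with the typed `vertexFactor` (Euler's e) the chain fails at s = 1.

## References
* [BalabanImbrieJaffe1988] T. Bałaban, J. Imbrie, A. Jaffe, Commun. Math. Phys. 114 (1988) 257–315, p. 298 (Sect. 5.10),
  (3.34)–(3.35) p. 270, (4.1) p. 273.
-/

namespace Literature.MathematicalPhysics.QuantumFieldTheory.BalabanImbrieJaffe1984to88.BIJ88W3Chain298

open Literature.MathematicalPhysics.QuantumFieldTheory.BalabanImbrieJaffe1984to88.BIJ88Sect5StatementsPart2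
open Literature.MathematicalPhysics.QuantumFieldTheory.BalabanImbrieJaffe1984to88.BIJ88Sect3Statements
open Literature.MathematicalPhysics.QuantumFieldTheory.BalabanImbrieJaffe1984to88.BIJ88Sect4Statements

/-! ## The two scalar steps of the second inequality -/

/-- The charge step of p. 298: for 0 < e ≤ 1 and β ≥ 0, (e^β)^{n̄+1} = e^{(n̄+1)β} ≤ e^{n̄β} (one factor e^β ≤ 1 is dropped, as in
the printed right side `e^{n̄β}`). [cite: BalabanImbrieJaffe1988, p.298 (Sect. 5.10)] -/
theorem rpow_pow_charge_le {e β : ℝ} (nbar : ℕ) (he0 : 0 < e) (he1 : e ≤ 1) (hβ : 0 ≤ β) :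
    (e ^ β) ^ (nbar + 1) ≤ e ^ ((nbar : ℝ) * β) := by
  rw [← Real.rpow_natCast, ← Real.rpow_mul he0.le]
  apply Real.rpow_le_rpow_of_exponent_ge he0 he1
  push_cast
  nlinarith

/-- The scale step of p. 298: for 0 < s ≤ 1 (s = L^kε/ε₀) and κ ≤ (n̄+1)(1/4 − α), (s^{1/4−α})^{n̄+1} ≤ s^κ — *"with κ > d as
large as desired if n̄ > n̄(κ)"*. [cite: BalabanImbrieJaffe1988, p.298 (Sect. 5.10)] -/
theorem rpow_pow_ratio_le {s α κ : ℝ} (nbar : ℕ) (hs0 : 0 < s) (hs1 : s ≤ 1)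
    (hκ : κ ≤ ((nbar : ℝ) + 1) * (1 / 4 - α)) :
    (s ^ (1 / 4 - α)) ^ (nbar + 1) ≤ s ^ κ := by
  rw [← Real.rpow_natCast, ← Real.rpow_mul hs0.le]
  apply Real.rpow_le_rpow_of_exponent_ge hs0 hs1
  push_cast
  linarith

/-- **p. 298, second inequality** (charge reading of e^β): [e^β s^{1/4−α}]^{n̄+1} ≤ e^{n̄β} s^κ for 0 < e ≤ 1, β ≥ 0, 0 < s ≤ 1 and
κ ≤ (n̄+1)(1/4 − α). [cite: BalabanImbrieJaffe1988, p.298 (Sect. 5.10)] -/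
theorem chain298 {e β s α κ : ℝ} (nbar : ℕ) (he0 : 0 < e) (he1 : e ≤ 1) (hβ : 0 ≤ β) (hs0 : 0 < s) (hs1 : s ≤ 1)
    (hκ : κ ≤ ((nbar : ℝ) + 1) * (1 / 4 - α)) :
    (e ^ β * s ^ (1 / 4 - α)) ^ (nbar + 1) ≤ e ^ ((nbar : ℝ) * β) * s ^ κ := by
  rw [mul_pow]
  exact mul_le_mul (rpow_pow_charge_le nbar he0 he1 hβ) (rpow_pow_ratio_le nbar hs0 hs1 hκ) (by positivity) (by positivity)

/-! ## Knitting with the first inequality (leaf `IneqW3`) and with the shape of (3.34) -/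

/-- **p. 298, the whole chain**: the first inequality (leaf `IneqW3` with θ = the vertex factor e^β s^{1/4−α}, charge reading)
gives |W₃^{(k)}(□)| ≤ e^{n̄β} s^κ for every cube. [cite: BalabanImbrieJaffe1988, p.298 (Sect. 5.10)] -/
theorem ineqW3_chain {Cube : Type} {W₃ : Cube → ℝ} {e β s α κ : ℝ} {nbar : ℕ}
    (h : IneqW3 Cube W₃ (e ^ β * s ^ (1 / 4 - α)) nbar) (he0 : 0 < e) (he1 : e ≤ 1) (hβ : 0 ≤ β) (hs0 : 0 < s)
    (hs1 : s ≤ 1) (hκ : κ ≤ ((nbar : ℝ) + 1) * (1 / 4 - α)) :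
    ∀ X : Cube, |W₃ X| ≤ e ^ ((nbar : ℝ) * β) * s ^ κ :=
  fun X => (h X).trans (chain298 nbar he0 he1 hβ hs0 hs1 hκ)

/-- The stopping rule of p. 273 (`Continues L ε ε₀ k`: L^kε < ε₀) makes the ratio s = L^kε/ε₀ at most 1 (for ε₀ > 0).
[cite: BalabanImbrieJaffe1988, (4.1) p.273] -/
theorem ratio_le_one_of_continues {L ε ε₀ : ℝ} {k : ℕ} (hc : Continues L ε ε₀ k) (hε₀ : 0 < ε₀) :
    L ^ k * ε / ε₀ ≤ 1 := by
  unfold Continues at hc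
  rw [div_le_one hε₀]
  exact hc.le

/-- **Level-k (3.34)-shape from p. 298.**  With s = L^kε/ε₀ the chain gives the typed shape `Ineq334 n̄ β (L^kε) ε₀ κ W₃` of
(3.34) p. 270 (*"|W₃^{(0)}(□)| ≦ e^{n̄β}(ε/ε₀)^κ"*, typed with `Real.exp (n̄β)`): in the charge reading e^{n̄β} ≤ 1 ≤ exp(n̄β), so
the typed right side is the weaker one.  Hypotheses: the first inequality of p. 298 (`IneqW3`), 0 < e ≤ 1, β ≥ 0, 0 < L^kε, the
stopping rule L^kε < ε₀, and κ ≤ (n̄+1)(1/4 − α). [cite: BalabanImbrieJaffe1988, (3.34) p.270] -/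
theorem ineq334_of_chain {Cube : Type} {W₃ : Cube → ℝ} {e β L ε ε₀ α κ : ℝ} {nbar k : ℕ}
    (h : IneqW3 Cube W₃ (e ^ β * (L ^ k * ε / ε₀) ^ (1 / 4 - α)) nbar) (he0 : 0 < e) (he1 : e ≤ 1) (hβ : 0 ≤ β)
    (hLε : 0 < L ^ k * ε) (hc : Continues L ε ε₀ k) (hκ : κ ≤ ((nbar : ℝ) + 1) * (1 / 4 - α)) :
    Ineq334 nbar β (L ^ k * ε) ε₀ κ W₃ := by
  have hε₀ : 0 < ε₀ := hLε.trans hc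
  have hs0 : 0 < L ^ k * ε / ε₀ := div_pos hLε hε₀
  have hs1 : L ^ k * ε / ε₀ ≤ 1 := ratio_le_one_of_continues hc hε₀
  intro q
  refine (ineqW3_chain h he0 he1 hβ hs0 hs1 hκ q).trans ?_
  apply mul_le_mul_of_nonneg_right _ (by positivity)
  calc e ^ ((nbar : ℝ) * β) ≤ 1 := Real.rpow_le_one he0.le he1 (by positivity)
    _ ≤ Real.exp ((nbar : ℝ) * β) := Real.one_le_exp (by positivity)

/-! ## The typed `vertexFactor` (Euler's e) does not support the printed chain without extra smallness -/

/-- TYPED-READING WITNESS.  With r16's `vertexFactor β s α = exp(β)·s^{1/4−α}` (Euler's e) the printed chain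
[θ]^{n̄+1} ≤ e^{n̄β} s^κ (right side read with exp as well) FAILS at s = L^kε/ε₀ = 1 for every β > 0 and every κ:
exp((n̄+1)β) > exp(n̄β).  (In the charge reading it holds for all 0 < s ≤ 1, `chain298`.)  Nothing printed fails; this only
records that the exp-reading needs L^kε/ε₀ small beyond the stopping rule. [cite: BalabanImbrieJaffe1988, p.298 (Sect. 5.10)] -/
theorem vertexFactor_chain_fails_at_one {β : ℝ} (hβ : 0 < β) (α κ : ℝ) (nbar : ℕ) :
    ¬ (vertexFactor β 1 α ^ (nbar + 1) ≤ Real.exp ((nbar : ℝ) * β) * (1 : ℝ) ^ κ) := by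
  intro h
  unfold vertexFactor at h
  rw [Real.one_rpow, Real.one_rpow, mul_one, mul_one, ← Real.exp_nat_mul] at h
  have : Real.exp ((nbar : ℝ) * β) < Real.exp ((↑(nbar + 1) : ℝ) * β) := by
    apply Real.exp_lt_exp.mpr
    push_cast
    linarith
  exact absurd h (not_le.mpr this)

/-! ## v1.1 (append-only): the chain inhabits the charge-reading statement (3.34)ᶜ of `BIJ88Sect3Statements` v1.3

r18's `BIJ88Sect3Statements.Ineq334c n̄ β e ε ε₀ κ W₃` (p252143; (3.34) with the letter `e` read as the CHARGE, the reading of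
record of GAPS G-C2-p36-04) is `∀ □, |W₃(□)| ≤ e ^ (n̄β) · (ε/ε₀) ^ κ`; at level k (ε ↦ L^kε) this is the conclusion of
`ineqW3_chain` term for term.  No declaration above is modified. -/

/-- **Level-k (3.34), charge reading, from p. 298.**  The first inequality of p. 298 (leaf `IneqW3` with θ = e^β s^{1/4−α},
s = L^kε/ε₀) together with the printed second inequality gives r18's `Ineq334c n̄ β e (L^kε) ε₀ κ W₃` for 0 < e ≤ 1, β ≥ 0,
0 < L^kε/ε₀ ≤ 1 and κ ≤ (n̄+1)(1/4 − α). [cite: BalabanImbrieJaffe1988, (3.34) p.270] -/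
theorem ineq334c_of_chain_ratio {Cube : Type} {W₃ : Cube → ℝ} {e β L ε ε₀ α κ : ℝ} {nbar k : ℕ}
    (h : IneqW3 Cube W₃ (e ^ β * (L ^ k * ε / ε₀) ^ (1 / 4 - α)) nbar) (he0 : 0 < e) (he1 : e ≤ 1) (hβ : 0 ≤ β)
    (hs0 : 0 < L ^ k * ε / ε₀) (hs1 : L ^ k * ε / ε₀ ≤ 1) (hκ : κ ≤ ((nbar : ℝ) + 1) * (1 / 4 - α)) :
    Ineq334c nbar β e (L ^ k * ε) ε₀ κ W₃ :=
  fun q => ineqW3_chain h he0 he1 hβ hs0 hs1 hκ q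

/-- **Level-k (3.34), charge reading, under the stopping rule of p. 273** (`Continues L ε ε₀ k`: L^kε < ε₀, with 0 < L^kε):
`IneqW3` with θ = e^β(L^kε/ε₀)^{1/4−α} ⟹ `Ineq334c n̄ β e (L^kε) ε₀ κ W₃` (the one-liner announced by r18, 2026-08-21T06:17Z).
The typed `Real.exp` shape `Ineq334` then follows by `Ineq334c.toIneq334_of_lt` (cf. `ineq334_of_chain`).
[cite: BalabanImbrieJaffe1988, (3.34) p.270] -/
theorem ineq334c_of_chain {Cube : Type} {W₃ : Cube → ℝ} {e β L ε ε₀ α κ : ℝ} {nbar k : ℕ}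
    (h : IneqW3 Cube W₃ (e ^ β * (L ^ k * ε / ε₀) ^ (1 / 4 - α)) nbar) (he0 : 0 < e) (he1 : e ≤ 1) (hβ : 0 ≤ β)
    (hLε : 0 < L ^ k * ε) (hc : Continues L ε ε₀ k) (hκ : κ ≤ ((nbar : ℝ) + 1) * (1 / 4 - α)) :
    Ineq334c nbar β e (L ^ k * ε) ε₀ κ W₃ :=
  have hε₀ : 0 < ε₀ := hLε.trans hc
  ineq334c_of_chain_ratio h he0 he1 hβ (div_pos hLε hε₀) (ratio_le_one_of_continues hc hε₀) hκ

/-- Consistency: the two routes to the typed `Ineq334` agree — via `Ineq334c` and `Ineq334c.toIneq334_of_lt`, under the stopping rule.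
[cite: BalabanImbrieJaffe1988, (3.34) p.270] -/
theorem ineq334_of_chain' {Cube : Type} {W₃ : Cube → ℝ} {e β L ε ε₀ α κ : ℝ} {nbar k : ℕ}
    (h : IneqW3 Cube W₃ (e ^ β * (L ^ k * ε / ε₀) ^ (1 / 4 - α)) nbar) (he0 : 0 < e) (he1 : e ≤ 1) (hβ : 0 ≤ β)
    (hLε : 0 < L ^ k * ε) (hc : Continues L ε ε₀ k) (hκ : κ ≤ ((nbar : ℝ) + 1) * (1 / 4 - α)) :
    Ineq334 nbar β (L ^ k * ε) ε₀ κ W₃ :=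
  (ineq334c_of_chain h he0 he1 hβ hLε hc hκ).toIneq334_of_lt he0.le he1 hβ hLε.le hc

end Literature.MathematicalPhysics.QuantumFieldTheory.BalabanImbrieJaffe1984to88.BIJ88W3Chain298
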